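import Literature.NumberTheory.Sieve.FriedlanderIwaniecPrimesJacobiTwistedPairBound
import HarnessLib

/-!
# Friedlander–Iwaniec, *The polynomial `X² + Y⁴` captures its primes*, §11: the estimate (11.23) for the dual form `W(D)`

Family `parity`, statement parity.S17 (`setOf_prime_sq_add_pow_four_infinite`). Source: J. Friedlander,
H. Iwaniec, Ann. of Math. (2) 148 (1998), 945–1040 [FriedlanderIwaniecAnnals1998], §11, proof of
Proposition 11.1, pp. 989–990, (11.19)–(11.23).

Sixth file of the §§11–14 unit. For the dual form `W = jtW D₁ D₂ R S γ` of (11.18) (moduli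
`D₁ < d ≤ D₂`) it PROVES

* `jtW_le_smoothed` (W1: the majorant `f`), `smoothed_eq_sum_pairs` / `jtW_le_norm_sum_pairTerm`
  (W2: "we square out and change the order of summation getting `W ≤ ∑_{d₁} ∑_{d₂} ∑_{a mod q}
  γ_{ad₁} γ̄_{ad₂} ∑_{r̄s ≡ a (q)} f(s) (r/d₁'d₂')`", `q = [d₁, d₂]`; the pair term is `jtPairTerm`);
* `square_part_le` — **(11.20)**: the pairs with `d₁'d₂' = □` contribute
  `≤ 4√D₂ (6RS/(D₁+1) + 3√(RS)) ‖γ‖²` (Lemma 11.2 via `sum_class_progressions_le`, and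
  `ν(d₁) ≤ 4√D₂`, `card_filter_isSquare_ordCompl_mul_le`);
* `exists_nonsquare_part_le` — **(11.21)–(11.22)**: the other pairs contribute
  `≤ C (S R^{3/4} + D₂R + D₂√(RS)) (D₂RS)^ε ‖γ‖²` (Cauchy's inequality with `σ(γ) ≤ ‖γ‖⁴`, the
  per-pair Poisson bound `exists_pair_form_bound`, Lemma 11.4 `sum_sq_coprime_jacobiSym_div_lcm_le`
  for the zero frequency);
* **`exists_jtW_le` — (11.23)**: for `0 < ε ≤ 1`,
  `W ≤ C {RS√D₂/(D₁+1) + (S R^{3/4} + D₂R + D₂√(RS)) (D₂RS)^ε} ‖γ‖²` for all `D₁, D₂`, `R, S ≥ 1`, `γ`.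
  With `D₁ = D`, `D₂ = 2D` this is the printed
  `W(D) ≪ {D^{-1/2} RS + (SR^{3/4} + RS^{3/4} + D√(RS) + DR)(RS)^ε} ‖γ‖²` except that the `ε`-factor
  is `(DRS)^ε` (FI: "we replaced `(DR)^ε` by `(RS)^ε` because if `D > RS` the estimate (11.23) is
  trivial" — that replacement is left to the sequel, where the symmetry `r ↔ s` and the removal of
  the term `DR` ((11.24) and the end of the proof of (11.19)) are carried out).

Everything is PROVED; the only definition is the pair term `jtPairTerm`.

## References

* J. Friedlander, H. Iwaniec, Ann. of Math. (2) 148 (1998), 945–1040, §11, (11.19)–(11.23).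
  [FriedlanderIwaniecAnnals1998]

## Tree / Mathlib

Tree: `jtW`, `jtNormSq`, `jtChar`, `congrSol`, `jtW_eq_sum_congrSol`, `congrSol_mod`,
`dvd_sub_mul_iff_eq_congrSol`, `sum_range_lcm_mul_mod_le`, `card_filter_isSquare_ordCompl_mul_le`
(`…JacobiTwistedForms`); `exists_pair_form_bound`, `norm_fourier_jtMajorantC_div_le_const`
(`…JacobiTwistedPairBound`); `card_congrPairs_le` (Lemma 11.2, `…JacobiTwistedLemmas`);
`sum_sq_coprime_jacobiSym_div_lcm_le` (Lemma 11.4, `…JacobiTwistedLemma114`). Mathlib: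
`Real.sum_mul_le_sqrt_mul_sqrt`, `Finset.sum_fiberwise_of_maps_to`, `Finset.sum_sigma`.
-/

noncomputable section

open Finset Real Complex MeasureTheory
open scoped FourierTransform ContDiff ComplexConjugate NumberTheorySymbols ArithmeticFunction.sigma Nat

namespace Literature.NumberTheory.Sieve.FriedlanderIwaniecPrimes

open LargeSieve (e)



/-! ### W1: the smooth majorant -/

/-- **Attaching the majorant:** `W ≤ ∑_r ∑_{0 ≤ s < 3S} f(s) |∑_{d:(r,d)=1} γ_d(s r̄) χ_d(r)|²`
("First we enlarge `W(D)` by attaching a smooth majorant `f(s)`"). [cite: FriedlanderIwaniecAnnals1998, §11, before (11.20)] -/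
theorem jtW_le_smoothed {S : ℕ} (hS : 1 ≤ S) (D₁ D₂ R : ℕ) (γ : ℕ → ℕ → ℂ) :
    jtW D₁ D₂ R S γ ≤ ∑ r ∈ Ioc R (2 * R), ∑ s ∈ range (3 * S), jtMajorant S s *
      ‖∑ d ∈ (Ioc D₁ D₂).filter (fun d => r.Coprime d), γ d (congrSol d r s) * (jtChar d r : ℂ)‖ ^ 2 := by
  rw [jtW_eq_sum_congrSol]
  refine sum_le_sum fun r _ => ?_
  have hSr : (0 : ℝ) < S := by exact_mod_cast (show 0 < S by omega)
  have hsub : Ioc S (2 * S) ⊆ range (3 * S) := by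
    intro s hs; rw [mem_Ioc] at hs; rw [mem_range]; omega
  calc ∑ s ∈ Ioc S (2 * S), ‖∑ d ∈ (Ioc D₁ D₂).filter (fun d => r.Coprime d),
        γ d (congrSol d r s) * (jtChar d r : ℂ)‖ ^ 2
      = ∑ s ∈ Ioc S (2 * S), jtMajorant S s * ‖∑ d ∈ (Ioc D₁ D₂).filter (fun d => r.Coprime d),
          γ d (congrSol d r s) * (jtChar d r : ℂ)‖ ^ 2 := by
        refine sum_congr rfl fun s hs => ?_
        rw [mem_Ioc] at hs
        rw [jtMajorant_eq_one hSr (by exact_mod_cast hs.1.le) (by exact_mod_cast hs.2), one_mul]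
    _ ≤ _ := sum_le_sum_of_subset_of_nonneg hsub fun s _ _ =>
        mul_nonneg (jtMajorant_nonneg _ _) (by positivity)

/-! ### W2: expanding the square and collecting the classes modulo `[d₁, d₂]` -/

/-- `χ_{d₁}(r) χ_{d₂}(r) = χ_{d₁d₂}(r)` (multiplicativity of the Jacobi symbol in the modulus and of
the odd part). [folklore] -/
theorem jtChar_mul_jtChar {d₁ d₂ : ℕ} (h₁ : 0 < d₁) (h₂ : 0 < d₂) (r : ℕ) :
    jtChar d₁ r * jtChar d₂ r = jtChar (d₁ * d₂) r := by
  rw [jtChar_def, jtChar_def, jtChar_def, ordCompl_two_mul,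
    jacobiSym.mul_right' _ (Nat.ordCompl_pos 2 h₁.ne').ne' (Nat.ordCompl_pos 2 h₂.ne').ne']

/-- `conj χ = χ` (the symbol is real). [folklore] -/
theorem conj_jtChar (d r : ℕ) : conj ((jtChar d r : ℤ) : ℂ) = (jtChar d r : ℂ) := by
  rw [← Complex.ofReal_intCast, Complex.conj_ofReal]

/-- **Collecting `s` by the class `a = s r̄ (mod q)`:** for `(r, q) = 1`,
`∑_{0 ≤ s < 3S} Φ(s, s r̄ mod q) = ∑_{a < q} ∑_{s ≡ a r (q)} Φ(s, a)`. [folklore] -/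
theorem sum_range_congrSol_eq {S q r : ℕ} (hq : 0 < q) (hr : r.Coprime q) (Φ : ℕ → ℕ → ℂ) :
    ∑ s ∈ range (3 * S), Φ s (congrSol q r s) =
      ∑ a ∈ range q, ∑ s ∈ (range (3 * S)).filter (fun s : ℕ => (q : ℤ) ∣ (s : ℤ) - ((a * r : ℕ) : ℤ)),
        Φ s a := by
  rw [← sum_fiberwise_of_maps_to (s := range (3 * S)) (t := range q) (g := fun s => congrSol q r s)
    (fun s _ => mem_range.mpr (congrSol_lt hq r s))]
  refine sum_congr rfl fun a ha => ?_
  rw [mem_range] at ha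
  have hiff : ∀ s : ℕ, congrSol q r s = a ↔ (q : ℤ) ∣ (s : ℤ) - ((a * r : ℕ) : ℤ) := by
    intro s
    rw [eq_comm, ← dvd_sub_mul_iff_eq_congrSol hq hr s ha]
    push_cast; exact Iff.rfl
  rw [filter_congr fun s _ => hiff s]
  refine sum_congr rfl fun s hs => ?_
  rw [mem_filter] at hs
  rw [← (hiff s).mpr hs.2]

/-- Swapping two outer sums past two inner ones. [folklore] -/
theorem sum_sum_sum_sum_comm {α β γ δ : Type*} {M : Type*} [AddCommMonoid M] (A : Finset α)
    (B : Finset β) (C : Finset γ) (D : Finset δ) (Φ : α → β → γ → δ → M) :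
    ∑ a ∈ A, ∑ b ∈ B, ∑ c ∈ C, ∑ d ∈ D, Φ a b c d =
      ∑ c ∈ C, ∑ d ∈ D, ∑ a ∈ A, ∑ b ∈ B, Φ a b c d := by
  calc ∑ a ∈ A, ∑ b ∈ B, ∑ c ∈ C, ∑ d ∈ D, Φ a b c d
      = ∑ a ∈ A, ∑ c ∈ C, ∑ b ∈ B, ∑ d ∈ D, Φ a b c d := sum_congr rfl fun _ _ => sum_comm
    _ = ∑ c ∈ C, ∑ a ∈ A, ∑ b ∈ B, ∑ d ∈ D, Φ a b c d := sum_comm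
    _ = ∑ c ∈ C, ∑ a ∈ A, ∑ d ∈ D, ∑ b ∈ B, Φ a b c d :=
        sum_congr rfl fun _ _ => sum_congr rfl fun _ _ => sum_comm
    _ = ∑ c ∈ C, ∑ d ∈ D, ∑ a ∈ A, ∑ b ∈ B, Φ a b c d := sum_congr rfl fun _ _ => sum_comm

/-- **W2.** With `𝒟 = (D₁, D₂]`, `q = [d₁, d₂]`, `U = {R < r ≤ 2R : (r, d₁d₂) = 1}`,
`F_q(c) = ∑_{s ≡ c (q)} f(s)`:
`∑_r ∑_s f(s) |∑_{d ∈ 𝒟, (r,d)=1} γ_d(s r̄) χ_d(r)|²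
   = ∑_{d₁, d₂ ∈ 𝒟} ∑_{a mod q} γ_{d₁}(a mod d₁) conj γ_{d₂}(a mod d₂) ∑_{r ∈ U} χ_{d₁d₂}(r) F_q(a r)`
("we square out and change the order of summation getting `W ≤ ∑_{d₁} ∑_{d₂} ∑_{a mod q} γ_{ad₁}
γ̄_{ad₂} ∑_{r̄s ≡ a (mod q)} f(s) (r/d₁'d₂')`"). [cite: FriedlanderIwaniecAnnals1998, §11, proof of (11.20)] -/
theorem smoothed_eq_sum_pairs (D₁ D₂ R S : ℕ) (γ : ℕ → ℕ → ℂ) :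
    ((∑ r ∈ Ioc R (2 * R), ∑ s ∈ range (3 * S), jtMajorant S s *
      ‖∑ d ∈ (Ioc D₁ D₂).filter (fun d => r.Coprime d), γ d (congrSol d r s) * (jtChar d r : ℂ)‖ ^ 2 : ℝ) : ℂ) =
    ∑ d₁ ∈ Ioc D₁ D₂, ∑ d₂ ∈ Ioc D₁ D₂, ∑ a ∈ range (Nat.lcm d₁ d₂),
      γ d₁ (a % d₁) * conj (γ d₂ (a % d₂)) *
        ∑ r ∈ (Ioc R (2 * R)).filter (fun r => r.Coprime (d₁ * d₂)), (jtChar (d₁ * d₂) r : ℂ) *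
          ∑ s ∈ (range (3 * S)).filter
            (fun s : ℕ => (Nat.lcm d₁ d₂ : ℤ) ∣ (s : ℤ) - ((a * r : ℕ) : ℤ)), (jtMajorant S s : ℂ) := by
  set 𝒟 := Ioc D₁ D₂ with h𝒟
  have h𝒟pos : ∀ d ∈ 𝒟, 0 < d := fun d hd => by rw [h𝒟, mem_Ioc] at hd; omega
  -- the summand after squaring out
  set Φ : ℕ → ℕ → ℕ → ℕ → ℂ := fun r s d₁ d₂ =>
    (jtMajorant S s : ℂ) * (γ d₁ (congrSol d₁ r s) * conj (γ d₂ (congrSol d₂ r s)) *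
      ((jtChar d₁ r : ℂ) * (jtChar d₂ r : ℂ))) with hΦ
  -- Step (a)-(b): expand the square for each `(r, s)`
  have hsq : ∀ r s : ℕ, ((jtMajorant S s *
      ‖∑ d ∈ 𝒟.filter (fun d => r.Coprime d), γ d (congrSol d r s) * (jtChar d r : ℂ)‖ ^ 2 : ℝ) : ℂ) =
      ∑ d₁ ∈ 𝒟.filter (fun d => r.Coprime d), ∑ d₂ ∈ 𝒟.filter (fun d => r.Coprime d), Φ r s d₁ d₂ := by
    intro r s
    push_cast
    rw [← Complex.ofReal_pow, ← Complex.normSq_eq_norm_sq, Complex.normSq_eq_conj_mul_self, mul_comm (conj _),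
      map_sum, sum_mul_sum, mul_sum]
    refine sum_congr rfl fun d₁ _ => ?_
    rw [mul_sum]
    refine sum_congr rfl fun d₂ _ => ?_
    rw [hΦ]; dsimp only
    rw [map_mul, conj_jtChar]; ring
  -- Step (e): the filtered `d`-sums with indicators
  have hind : ∀ r s : ℕ,
      ∑ d₁ ∈ 𝒟.filter (fun d => r.Coprime d), ∑ d₂ ∈ 𝒟.filter (fun d => r.Coprime d), Φ r s d₁ d₂ =
        ∑ d₁ ∈ 𝒟, ∑ d₂ ∈ 𝒟, if r.Coprime (d₁ * d₂) then Φ r s d₁ d₂ else 0 := by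
    intro r s
    rw [sum_filter]
    refine sum_congr rfl fun d₁ _ => ?_
    by_cases h1 : r.Coprime d₁
    · rw [if_pos h1, sum_filter]
      refine sum_congr rfl fun d₂ _ => ?_
      by_cases h2 : r.Coprime d₂
      · rw [if_pos h2, if_pos (Nat.Coprime.mul_right h1 h2)]
      · rw [if_neg h2, if_neg (fun h => h2 (Nat.Coprime.coprime_mul_left_right h))]
    · rw [if_neg h1]
      refine (sum_eq_zero fun d₂ _ => if_neg fun h => h1 (Nat.Coprime.coprime_mul_right_right h)).symm
  -- Steps (c)-(d): for fixed `d₁, d₂` and `r ∈ U`, collect `s` by the class modulo `q`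
  have hinner : ∀ d₁ ∈ 𝒟, ∀ d₂ ∈ 𝒟, ∀ r : ℕ, r.Coprime (d₁ * d₂) →
      ∑ s ∈ range (3 * S), Φ r s d₁ d₂ =
        ∑ a ∈ range (Nat.lcm d₁ d₂), γ d₁ (a % d₁) * conj (γ d₂ (a % d₂)) *
          ((jtChar (d₁ * d₂) r : ℂ) * ∑ s ∈ (range (3 * S)).filter
            (fun s : ℕ => (Nat.lcm d₁ d₂ : ℤ) ∣ (s : ℤ) - ((a * r : ℕ) : ℤ)), (jtMajorant S s : ℂ)) := by
    intro d₁ hd₁ d₂ hd₂ r hr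
    have h1 := h𝒟pos d₁ hd₁
    have h2 := h𝒟pos d₂ hd₂
    have hq : 0 < Nat.lcm d₁ d₂ := Nat.lcm_pos h1 h2
    have hrq : r.Coprime (Nat.lcm d₁ d₂) := hr.coprime_dvd_right (Nat.lcm_dvd_mul d₁ d₂)
    -- replace the two classes by the class modulo `q`
    have hmod : ∀ s, Φ r s d₁ d₂ = (jtMajorant S s : ℂ) *
        (γ d₁ (congrSol (Nat.lcm d₁ d₂) r s % d₁) * conj (γ d₂ (congrSol (Nat.lcm d₁ d₂) r s % d₂)) *
          (jtChar (d₁ * d₂) r : ℂ)) := by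
      intro s
      rw [hΦ]; dsimp only
      rw [congrSol_mod hq h1 (Nat.dvd_lcm_left d₁ d₂) hrq, congrSol_mod hq h2 (Nat.dvd_lcm_right d₁ d₂) hrq,
        ← jtChar_mul_jtChar h1 h2, Int.cast_mul]
    simp_rw [hmod]
    rw [sum_range_congrSol_eq hq hrq (fun s a => (jtMajorant S s : ℂ) *
      (γ d₁ (a % d₁) * conj (γ d₂ (a % d₂)) * (jtChar (d₁ * d₂) r : ℂ)))]
    refine sum_congr rfl fun a _ => ?_
    rw [mul_sum, mul_sum]
    exact sum_congr rfl fun s _ => by ring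
  -- assemble
  calc ((∑ r ∈ Ioc R (2 * R), ∑ s ∈ range (3 * S), jtMajorant S s *
        ‖∑ d ∈ 𝒟.filter (fun d => r.Coprime d), γ d (congrSol d r s) * (jtChar d r : ℂ)‖ ^ 2 : ℝ) : ℂ)
      = ∑ r ∈ Ioc R (2 * R), ∑ s ∈ range (3 * S),
          ∑ d₁ ∈ 𝒟, ∑ d₂ ∈ 𝒟, if r.Coprime (d₁ * d₂) then Φ r s d₁ d₂ else 0 := by
        push_cast
        refine sum_congr rfl fun r _ => sum_congr rfl fun s _ => ?_
        have := hsq r s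
        push_cast at this
        rw [this, hind]
    _ = ∑ d₁ ∈ 𝒟, ∑ d₂ ∈ 𝒟, ∑ r ∈ Ioc R (2 * R), ∑ s ∈ range (3 * S),
          if r.Coprime (d₁ * d₂) then Φ r s d₁ d₂ else 0 := sum_sum_sum_sum_comm _ _ _ _ _
    _ = ∑ d₁ ∈ 𝒟, ∑ d₂ ∈ 𝒟, ∑ r ∈ (Ioc R (2 * R)).filter (fun r => r.Coprime (d₁ * d₂)),
          ∑ s ∈ range (3 * S), Φ r s d₁ d₂ := by
        refine sum_congr rfl fun d₁ _ => sum_congr rfl fun d₂ _ => ?_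
        rw [sum_filter]
        refine sum_congr rfl fun r _ => ?_
        split_ifs <;> simp
    _ = _ := by
        refine sum_congr rfl fun d₁ hd₁ => sum_congr rfl fun d₂ hd₂ => ?_
        rw [sum_congr rfl fun r hr => hinner d₁ hd₁ d₂ hd₂ r (mem_filter.mp hr).2, sum_comm]
        refine sum_congr rfl fun a _ => ?_
        rw [mul_sum]





/-! ### W4: the pairs with `d₁' d₂'` a square -/

/-- For `(r, q) = 1` and `a₁`, at most one `a < q` has `q ∣ s - a r`, and if moreover
`a ≡ a₁ (mod d₁)` with `d₁ ∣ q` then `d₁ ∣ s - a₁ r`. [folklore] -/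
theorem card_filter_class_le_ite {q d₁ r s a₁ : ℕ} (hq : 0 < q) (hd₁q : d₁ ∣ q) (hr : r.Coprime q) :
    (#((range q).filter fun a => a % d₁ = a₁ % d₁ ∧ (q : ℤ) ∣ (s : ℤ) - (a : ℤ) * r) : ℝ) ≤
      if (d₁ : ℤ) ∣ (s : ℤ) - (a₁ : ℤ) * r then 1 else 0 := by
  set F := (range q).filter fun a => a % d₁ = a₁ % d₁ ∧ (q : ℤ) ∣ (s : ℤ) - (a : ℤ) * r with hF
  have hsub : F ⊆ {congrSol q r s} := by
    intro a ha
    rw [hF, mem_filter, mem_range] at ha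
    rw [mem_singleton]
    exact (dvd_sub_mul_iff_eq_congrSol hq hr s ha.1).mp ha.2.2
  have hcard : #F ≤ 1 := (card_le_card hsub).trans (card_singleton _).le
  split_ifs with h
  · exact_mod_cast hcard
  · -- `F` is empty
    have : F = ∅ := by
      refine filter_eq_empty_iff.mpr fun a ha hcon => h ?_
      have h1 : (d₁ : ℤ) ∣ (s : ℤ) - (a : ℤ) * r := (Int.natCast_dvd_natCast.mpr hd₁q).trans hcon.2
      have h2 : (d₁ : ℤ) ∣ ((a : ℤ) - a₁) * r := by
        refine Dvd.dvd.mul_right ?_ _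
        have hm : a₁ % d₁ = a % d₁ := hcon.1.symm
        have := (Nat.modEq_iff_dvd.mp hm)
        exact this
      have := dvd_add h1 h2
      have he : (s : ℤ) - (a : ℤ) * r + ((a : ℤ) - a₁) * r = (s : ℤ) - (a₁ : ℤ) * r := by ring
      rwa [he] at this
    rw [this, card_empty, Nat.cast_zero]





/-- `min(2R, 3S) ≤ 3 √(RS)`. [folklore] -/
theorem min_two_three_le_sqrt (R S : ℕ) : min (2 * (R : ℝ)) (3 * S) ≤ 3 * Real.sqrt ((R : ℝ) * S) := by
  have hR : (0 : ℝ) ≤ R := Nat.cast_nonneg R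
  have hS : (0 : ℝ) ≤ S := Nat.cast_nonneg S
  have hm0 : 0 ≤ min (2 * (R : ℝ)) (3 * S) := le_min (by positivity) (by positivity)
  have hsq : (min (2 * (R : ℝ)) (3 * S)) ^ 2 ≤ (3 * Real.sqrt ((R : ℝ) * S)) ^ 2 := by
    rw [mul_pow, Real.sq_sqrt (by positivity)]
    rcases le_total (2 * (R : ℝ)) (3 * S) with h | h
    · rw [min_eq_left h]; nlinarith
    · rw [min_eq_right h]; nlinarith
  exact pow_le_pow_iff_left₀ hm0 (by positivity) two_ne_zero |>.mp hsq





/-- **The count behind (11.20):** for `d₁ ∣ q`, `U ⊆ (R, 2R]` consisting of `r` coprime to `q`,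
and any class `a₁`,
`∑_{a < q, a ≡ a₁ (d₁)} ∑_{r ∈ U} ∑_{0 ≤ s < 3S, s ≡ ar (q)} f(s) ≤ 6RS/d₁ + 3√(RS)`
(at most one `a` for each `(r, s)`, and then `d₁ ∣ s − a₁ r`; Lemma 11.2 with `(a₁, 1, d₁) = 1`).
[cite: FriedlanderIwaniecAnnals1998, §11, proof of (11.20)] -/
theorem sum_class_progressions_le {q d₁ R S : ℕ} (hq : 0 < q) (hd₁ : 0 < d₁) (hd₁q : d₁ ∣ q)
    (hS : 1 ≤ S) (U : Finset ℕ) (hU : U ⊆ Ioc R (2 * R)) (hUq : ∀ r ∈ U, r.Coprime q) (a₁ : ℕ) :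
    ∑ a ∈ (range q).filter (fun a => a % d₁ = a₁ % d₁), ∑ r ∈ U,
      ∑ s ∈ (range (3 * S)).filter (fun s : ℕ => (q : ℤ) ∣ (s : ℤ) - ((a * r : ℕ) : ℤ)), jtMajorant S s ≤
      6 * R * S / d₁ + 3 * Real.sqrt ((R : ℝ) * S) := by
  have hSr : (0 : ℝ) < S := by exact_mod_cast (show 0 < S by omega)
  set ind : ℕ → ℕ → ℝ := fun r s => if (d₁ : ℤ) ∣ (s : ℤ) - (a₁ : ℤ) * r then 1 else 0 with hind
  -- Step 1: for each `(r, s)` at most one `a`, and then `d₁ ∣ s - a₁ r`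
  have h1 : ∑ a ∈ (range q).filter (fun a => a % d₁ = a₁ % d₁), ∑ r ∈ U,
      ∑ s ∈ (range (3 * S)).filter (fun s : ℕ => (q : ℤ) ∣ (s : ℤ) - ((a * r : ℕ) : ℤ)), jtMajorant S s ≤
      ∑ r ∈ U, ∑ s ∈ range (3 * S), jtMajorant S s * ind r s := by
    calc _ = ∑ a ∈ (range q).filter (fun a => a % d₁ = a₁ % d₁), ∑ r ∈ U, ∑ s ∈ range (3 * S),
          (if (q : ℤ) ∣ (s : ℤ) - ((a * r : ℕ) : ℤ) then jtMajorant S s else 0) := by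
            refine sum_congr rfl fun a _ => sum_congr rfl fun r _ => ?_
            rw [sum_filter]
      _ = ∑ r ∈ U, ∑ s ∈ range (3 * S), ∑ a ∈ (range q).filter (fun a => a % d₁ = a₁ % d₁),
          (if (q : ℤ) ∣ (s : ℤ) - ((a * r : ℕ) : ℤ) then jtMajorant S s else 0) := by
            rw [sum_comm]; exact sum_congr rfl fun r _ => sum_comm
      _ = ∑ r ∈ U, ∑ s ∈ range (3 * S), jtMajorant S s *
          #((range q).filter fun a => a % d₁ = a₁ % d₁ ∧ (q : ℤ) ∣ (s : ℤ) - (a : ℤ) * r) := by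
            refine sum_congr rfl fun r _ => sum_congr rfl fun s _ => ?_
            rw [← sum_filter, sum_const, nsmul_eq_mul, mul_comm, filter_filter]
            congr 2
      _ ≤ ∑ r ∈ U, ∑ s ∈ range (3 * S), jtMajorant S s * ind r s := by
            refine sum_le_sum fun r hr => sum_le_sum fun s _ => ?_
            exact mul_le_mul_of_nonneg_left (card_filter_class_le_ite hq hd₁q (hUq r hr)) (jtMajorant_nonneg _ _)
  -- Step 2: drop `f ≤ 1` and `s = 0`
  have h2 : ∀ r ∈ U, ∑ s ∈ range (3 * S), jtMajorant S s * ind r s ≤ ∑ s ∈ Icc 1 (3 * S), ind r s := by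
    intro r _
    have hind0 : ∀ s, 0 ≤ ind r s := fun s => by rw [hind]; dsimp only; split_ifs <;> norm_num
    calc ∑ s ∈ range (3 * S), jtMajorant S s * ind r s
        = ∑ s ∈ (range (3 * S)).filter (fun s => 1 ≤ s), jtMajorant S s * ind r s := by
          rw [sum_filter]
          refine sum_congr rfl fun s _ => ?_
          split_ifs with hs
          · rfl
          · have : s = 0 := by omega
            rw [this, Nat.cast_zero, jtMajorant_eq_zero hSr (Or.inl (by positivity)), zero_mul]
      _ ≤ ∑ s ∈ (range (3 * S)).filter (fun s => 1 ≤ s), ind r s := by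
          refine sum_le_sum fun s _ => ?_
          calc jtMajorant S s * ind r s ≤ 1 * ind r s :=
                mul_le_mul_of_nonneg_right (jtMajorant_le_one _ _) (hind0 s)
            _ = ind r s := one_mul _
      _ ≤ ∑ s ∈ Icc 1 (3 * S), ind r s := by
          refine sum_le_sum_of_subset_of_nonneg ?_ fun s _ _ => hind0 s
          intro s hs; rw [mem_filter, mem_range] at hs; rw [mem_Icc]; omega
  -- Step 3: Lemma 11.2
  have h3 : ∑ r ∈ U, ∑ s ∈ Icc 1 (3 * S), ind r s ≤
      #(((Icc 1 (2 * R)) ×ˢ (Icc 1 (3 * S))).filter fun rs : ℕ × ℕ =>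
        (d₁ : ℤ) ∣ (a₁ : ℤ) * rs.1 - 1 * rs.2) := by
    have hU' : U ⊆ Icc 1 (2 * R) := fun r hr => by
      have := mem_Ioc.mp (hU hr); rw [mem_Icc]; omega
    calc ∑ r ∈ U, ∑ s ∈ Icc 1 (3 * S), ind r s ≤ ∑ r ∈ Icc 1 (2 * R), ∑ s ∈ Icc 1 (3 * S), ind r s := by
          refine sum_le_sum_of_subset_of_nonneg hU' fun r _ _ => sum_nonneg fun s _ => ?_
          rw [hind]; dsimp only; split_ifs <;> norm_num
      _ = _ := by
          rw [card_filter, sum_product]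
          push_cast
          refine sum_congr rfl fun r _ => sum_congr rfl fun s _ => ?_
          rw [hind]; dsimp only
          have : (d₁ : ℤ) ∣ (s : ℤ) - (a₁ : ℤ) * r ↔ (d₁ : ℤ) ∣ (a₁ : ℤ) * r - 1 * s := by
            rw [one_mul, ← dvd_neg, neg_sub]
          simp only [this]
  have h4 := card_congrPairs_le (a := (a₁ : ℤ)) (b := 1) hd₁ (by rw [Int.gcd_one_right]; exact Nat.coprime_one_left d₁)
    (2 * R) (3 * S)
  calc _ ≤ ∑ r ∈ U, ∑ s ∈ range (3 * S), jtMajorant S s * ind r s := h1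
    _ ≤ ∑ r ∈ U, ∑ s ∈ Icc 1 (3 * S), ind r s := sum_le_sum h2
    _ ≤ _ := h3
    _ ≤ ((2 * R : ℕ) : ℝ) * ((3 * S : ℕ) : ℝ) / d₁ + min ((2 * R : ℕ) : ℝ) ((3 * S : ℕ) : ℝ) := h4
    _ ≤ 6 * R * S / d₁ + 3 * Real.sqrt ((R : ℝ) * S) := by
        push_cast
        have := min_two_three_le_sqrt R S
        have he : (2 * (R : ℝ)) * (3 * S) / d₁ = 6 * R * S / d₁ := by ring
        rw [he]
        linarith





/-- **The bound for one pair `(d₁, d₂)` by trivial estimation** (the route to (11.20)):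
`|T(d₁,d₂)| ≤ ½ (M₁ ‖γ_{d₁}‖² + M₂ ‖γ_{d₂}‖²)` with `Mᵢ = 6RS/dᵢ + 3√(RS)`, where
`T(d₁,d₂) = ∑_{a mod q} γ_{d₁}(a) γ̄_{d₂}(a) ∑_{r ∈ U} χ(r) F_q(ar)` (`|γγ̄| ≤ ½(|γ₁|² + |γ₂|²)`,
`|χ| ≤ 1`, `f ≥ 0`, and `sum_class_progressions_le`). [cite: FriedlanderIwaniecAnnals1998, §11, proof of (11.20)] -/
theorem norm_pairTerm_le {d₁ d₂ R S : ℕ} (hd₁ : 0 < d₁) (hd₂ : 0 < d₂) (hS : 1 ≤ S) (γ : ℕ → ℕ → ℂ) :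
    ‖∑ a ∈ range (Nat.lcm d₁ d₂), γ d₁ (a % d₁) * conj (γ d₂ (a % d₂)) *
        ∑ r ∈ (Ioc R (2 * R)).filter (fun r => r.Coprime (d₁ * d₂)), (jtChar (d₁ * d₂) r : ℂ) *
          ∑ s ∈ (range (3 * S)).filter
            (fun s : ℕ => (Nat.lcm d₁ d₂ : ℤ) ∣ (s : ℤ) - ((a * r : ℕ) : ℤ)), (jtMajorant S s : ℂ)‖ ≤
      ((6 * R * S / d₁ + 3 * Real.sqrt ((R : ℝ) * S)) * ∑ a₁ ∈ range d₁, ‖γ d₁ a₁‖ ^ 2 +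
        (6 * R * S / d₂ + 3 * Real.sqrt ((R : ℝ) * S)) * ∑ a₂ ∈ range d₂, ‖γ d₂ a₂‖ ^ 2) / 2 := by
  set q := Nat.lcm d₁ d₂ with hqdef
  have hq : 0 < q := Nat.lcm_pos hd₁ hd₂
  set U := (Ioc R (2 * R)).filter (fun r => r.Coprime (d₁ * d₂)) with hUdef
  have hU : U ⊆ Ioc R (2 * R) := filter_subset _ _
  have hUq : ∀ r ∈ U, r.Coprime q := fun r hr =>
    (mem_filter.mp hr).2.coprime_dvd_right (Nat.lcm_dvd_mul d₁ d₂)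
  set Yabs : ℕ → ℝ := fun a => ∑ r ∈ U,
    ∑ s ∈ (range (3 * S)).filter (fun s : ℕ => (q : ℤ) ∣ (s : ℤ) - ((a * r : ℕ) : ℤ)), jtMajorant S s
    with hYabs
  have hYabs0 : ∀ a, 0 ≤ Yabs a := fun a =>
    sum_nonneg fun _ _ => sum_nonneg fun _ _ => jtMajorant_nonneg _ _
  -- `‖Y(a)‖ ≤ Yabs(a)`
  have hY : ∀ a, ‖∑ r ∈ U, (jtChar (d₁ * d₂) r : ℂ) *
      ∑ s ∈ (range (3 * S)).filter (fun s : ℕ => (q : ℤ) ∣ (s : ℤ) - ((a * r : ℕ) : ℤ)),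
        (jtMajorant S s : ℂ)‖ ≤ Yabs a := by
    intro a
    refine (norm_sum_le _ _).trans (sum_le_sum fun r _ => ?_)
    rw [norm_mul]
    calc _ ≤ 1 * ‖∑ s ∈ (range (3 * S)).filter (fun s : ℕ => (q : ℤ) ∣ (s : ℤ) - ((a * r : ℕ) : ℤ)),
          (jtMajorant S s : ℂ)‖ := mul_le_mul_of_nonneg_right (norm_jtChar_le_one _ _) (norm_nonneg _)
      _ ≤ _ := by
          rw [one_mul]
          refine (norm_sum_le _ _).trans (le_of_eq (sum_congr rfl fun s _ => ?_))
          rw [Complex.norm_real, Real.norm_eq_abs, abs_of_nonneg (jtMajorant_nonneg _ _)]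
  -- fibre sums over the class modulo `dᵢ`
  have hfib : ∀ {d : ℕ}, 0 < d → d ∣ q → ∀ (u : ℕ → ℝ), (∀ a, 0 ≤ u a) →
      ∑ a ∈ range q, u (a % d) * Yabs a ≤ (6 * R * S / d + 3 * Real.sqrt ((R : ℝ) * S)) *
        ∑ a₁ ∈ range d, u a₁ := by
    intro d hd hdq u hu
    rw [← sum_fiberwise_of_maps_to (s := range q) (t := range d) (g := fun a => a % d)
      (fun a _ => mem_range.mpr (Nat.mod_lt _ hd)), mul_sum]
    refine sum_le_sum fun a₁ ha₁ => ?_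
    rw [mem_range] at ha₁
    have hcount := sum_class_progressions_le hq hd hdq hS U hU hUq a₁
    rw [Nat.mod_eq_of_lt ha₁] at hcount
    calc ∑ a ∈ (range q).filter (fun a => a % d = a₁), u (a % d) * Yabs a
        = u a₁ * ∑ a ∈ (range q).filter (fun a => a % d = a₁), Yabs a := by
          rw [mul_sum]
          refine sum_congr rfl fun a ha => ?_
          rw [(mem_filter.mp ha).2]
      _ ≤ u a₁ * (6 * R * S / d + 3 * Real.sqrt ((R : ℝ) * S)) :=
          mul_le_mul_of_nonneg_left hcount (hu a₁)
      _ = _ := mul_comm _ _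
  -- assemble
  calc _ ≤ ∑ a ∈ range q, ‖γ d₁ (a % d₁) * conj (γ d₂ (a % d₂)) *
        ∑ r ∈ U, (jtChar (d₁ * d₂) r : ℂ) *
          ∑ s ∈ (range (3 * S)).filter (fun s : ℕ => (q : ℤ) ∣ (s : ℤ) - ((a * r : ℕ) : ℤ)),
            (jtMajorant S s : ℂ)‖ := norm_sum_le _ _
    _ ≤ ∑ a ∈ range q, ‖γ d₁ (a % d₁)‖ * ‖γ d₂ (a % d₂)‖ * Yabs a := by
        refine sum_le_sum fun a _ => ?_
        rw [norm_mul, norm_mul, Complex.norm_conj]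
        exact mul_le_mul_of_nonneg_left (hY a) (by positivity)
    _ ≤ ∑ a ∈ range q, (‖γ d₁ (a % d₁)‖ ^ 2 + ‖γ d₂ (a % d₂)‖ ^ 2) / 2 * Yabs a := by
        refine sum_le_sum fun a _ => mul_le_mul_of_nonneg_right ?_ (hYabs0 a)
        nlinarith [sq_nonneg (‖γ d₁ (a % d₁)‖ - ‖γ d₂ (a % d₂)‖)]
    _ = (∑ a ∈ range q, ‖γ d₁ (a % d₁)‖ ^ 2 * Yabs a + ∑ a ∈ range q, ‖γ d₂ (a % d₂)‖ ^ 2 * Yabs a) / 2 := by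
        rw [← sum_add_distrib, Finset.sum_div]
        exact sum_congr rfl fun a _ => by ring
    _ ≤ _ := by
        gcongr
        · exact hfib hd₁ (Nat.dvd_lcm_left d₁ d₂) (fun a => ‖γ d₁ a‖ ^ 2) fun a => by positivity
        · exact hfib hd₂ (Nat.dvd_lcm_right d₁ d₂) (fun a => ‖γ d₂ a‖ ^ 2) fun a => by positivity





/-- The term of the pair `(d₁, d₂)` after squaring out (W2):
`T(d₁,d₂) = ∑_{a mod [d₁,d₂]} γ_{d₁}(a) γ̄_{d₂}(a) ∑_{R<r≤2R, (r,d₁d₂)=1} χ_{d₁d₂}(r) F_{[d₁,d₂]}(ar)`.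
[cite: FriedlanderIwaniecAnnals1998, §11, proof of (11.20)] -/
def jtPairTerm (R S : ℕ) (γ : ℕ → ℕ → ℂ) (d₁ d₂ : ℕ) : ℂ :=
  ∑ a ∈ range (Nat.lcm d₁ d₂), γ d₁ (a % d₁) * conj (γ d₂ (a % d₂)) *
    ∑ r ∈ (Ioc R (2 * R)).filter (fun r => r.Coprime (d₁ * d₂)), (jtChar (d₁ * d₂) r : ℂ) *
      ∑ s ∈ (range (3 * S)).filter
        (fun s : ℕ => (Nat.lcm d₁ d₂ : ℤ) ∣ (s : ℤ) - ((a * r : ℕ) : ℤ)), (jtMajorant S s : ℂ)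

/-- Unfolding `jtPairTerm`. [folklore] -/
theorem jtPairTerm_def (R S : ℕ) (γ : ℕ → ℕ → ℂ) (d₁ d₂ : ℕ) : jtPairTerm R S γ d₁ d₂ =
    ∑ a ∈ range (Nat.lcm d₁ d₂), γ d₁ (a % d₁) * conj (γ d₂ (a % d₂)) *
      ∑ r ∈ (Ioc R (2 * R)).filter (fun r => r.Coprime (d₁ * d₂)), (jtChar (d₁ * d₂) r : ℂ) *
        ∑ s ∈ (range (3 * S)).filter
          (fun s : ℕ => (Nat.lcm d₁ d₂ : ℤ) ∣ (s : ℤ) - ((a * r : ℕ) : ℤ)), (jtMajorant S s : ℂ) := rfl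

/-- **W1 + W2:** `W ≤ ‖∑_{d₁, d₂ ∈ 𝒟} T(d₁, d₂)‖`. [cite: FriedlanderIwaniecAnnals1998, §11, proof of (11.20)] -/
theorem jtW_le_norm_sum_pairTerm {S : ℕ} (hS : 1 ≤ S) (D₁ D₂ R : ℕ) (γ : ℕ → ℕ → ℂ) :
    jtW D₁ D₂ R S γ ≤ ‖∑ d₁ ∈ Ioc D₁ D₂, ∑ d₂ ∈ Ioc D₁ D₂, jtPairTerm R S γ d₁ d₂‖ := by
  refine (jtW_le_smoothed hS D₁ D₂ R γ).trans (le_of_eq ?_)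
  have h := smoothed_eq_sum_pairs D₁ D₂ R S γ
  simp only [← jtPairTerm_def] at h
  rw [← h, Complex.norm_real, Real.norm_eq_abs, abs_of_nonneg]
  exact sum_nonneg fun _ _ => sum_nonneg fun _ _ => mul_nonneg (jtMajorant_nonneg _ _) (by positivity)

/-- **(11.20), the square pairs:** with `𝒟 = (D₁, D₂]`, `R, S ≥ 1`,
`∑_{d₁,d₂ ∈ 𝒟, (d₁d₂)' = □} |T(d₁,d₂)| ≤ 4√D₂ (6RS/(D₁+1) + 3√(RS)) ‖γ‖²`
("`W^□ ≪ (D^{-1/2} RS + √(DRS)) ‖γ‖²`": `norm_pairTerm_le` and `ν(d) ≤ 4√D₂`,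
`card_filter_isSquare_ordCompl_mul_le`). [cite: FriedlanderIwaniecAnnals1998, §11, (11.20)] -/
theorem square_part_le {S : ℕ} (hS : 1 ≤ S) (D₁ D₂ R : ℕ) (γ : ℕ → ℕ → ℂ) :
    ∑ d₁ ∈ Ioc D₁ D₂, ∑ d₂ ∈ (Ioc D₁ D₂).filter (fun d₂ => IsSquare (ordCompl[2] (d₁ * d₂))),
      ‖jtPairTerm R S γ d₁ d₂‖ ≤
      4 * Real.sqrt D₂ * (6 * R * S / (D₁ + 1) + 3 * Real.sqrt ((R : ℝ) * S)) * jtNormSq D₁ D₂ γ := by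
  set 𝒟 := Ioc D₁ D₂ with h𝒟
  set M : ℝ := 6 * R * S / (D₁ + 1) + 3 * Real.sqrt ((R : ℝ) * S) with hM
  have hM0 : 0 ≤ M := by positivity
  set u : ℕ → ℝ := fun d => ∑ a ∈ range d, ‖γ d a‖ ^ 2 with hu
  have hu0 : ∀ d, 0 ≤ u d := fun d => sum_nonneg fun _ _ => by positivity
  have h𝒟 : ∀ d ∈ 𝒟, 0 < d ∧ (D₁ : ℝ) + 1 ≤ d ∧ d ≤ D₂ := fun d hd => by
    rw [mem_Ioc] at hd
    exact ⟨by omega, by exact_mod_cast hd.1, hd.2⟩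
  -- per pair
  have hpair : ∀ d₁ ∈ 𝒟, ∀ d₂ ∈ 𝒟, ‖jtPairTerm R S γ d₁ d₂‖ ≤ M / 2 * (u d₁ + u d₂) := by
    intro d₁ hd₁ d₂ hd₂
    obtain ⟨h1, h1', -⟩ := h𝒟 d₁ hd₁
    obtain ⟨h2, h2', -⟩ := h𝒟 d₂ hd₂
    refine (norm_pairTerm_le h1 h2 hS γ).trans ?_
    have hM₁ : 6 * R * S / d₁ + 3 * Real.sqrt ((R : ℝ) * S) ≤ M := by
      rw [hM]; gcongr
    have hM₂ : 6 * R * S / d₂ + 3 * Real.sqrt ((R : ℝ) * S) ≤ M := by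
      rw [hM]; gcongr
    rw [div_le_iff₀ (by norm_num : (0:ℝ) < 2)]
    have := hu0 d₁; have := hu0 d₂
    calc _ ≤ M * u d₁ + M * u d₂ := add_le_add (mul_le_mul_of_nonneg_right hM₁ (hu0 d₁))
          (mul_le_mul_of_nonneg_right hM₂ (hu0 d₂))
      _ = M / 2 * (u d₁ + u d₂) * 2 := by ring
  -- the counts `ν`
  have hν : ∀ d ∈ 𝒟, (#(𝒟.filter fun d' => IsSquare (ordCompl[2] (d * d'))) : ℝ) ≤ 4 * Real.sqrt D₂ := by
    intro d hd
    have h1 := (h𝒟 d hd).1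
    calc (#(𝒟.filter fun d' => IsSquare (ordCompl[2] (d * d'))) : ℝ)
        ≤ #((Icc 1 D₂).filter fun d' => IsSquare (ordCompl[2] (d * d'))) := by
          exact_mod_cast card_le_card (filter_subset_filter _ fun d' hd' => by
            rw [mem_Ioc] at hd'; rw [mem_Icc]; omega)
      _ ≤ 4 * Real.sqrt D₂ := card_filter_isSquare_ordCompl_mul_le h1 D₂
  -- the two pieces
  have hP1 : ∑ d₁ ∈ 𝒟, ∑ d₂ ∈ 𝒟.filter (fun d₂ => IsSquare (ordCompl[2] (d₁ * d₂))), u d₁ ≤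
      4 * Real.sqrt D₂ * ∑ d ∈ 𝒟, u d := by
    rw [mul_sum]
    refine sum_le_sum fun d₁ hd₁ => ?_
    rw [sum_const, nsmul_eq_mul]
    exact mul_le_mul_of_nonneg_right (hν d₁ hd₁) (hu0 d₁)
  have hP2 : ∑ d₁ ∈ 𝒟, ∑ d₂ ∈ 𝒟.filter (fun d₂ => IsSquare (ordCompl[2] (d₁ * d₂))), u d₂ ≤
      4 * Real.sqrt D₂ * ∑ d ∈ 𝒟, u d := by
    calc ∑ d₁ ∈ 𝒟, ∑ d₂ ∈ 𝒟.filter (fun d₂ => IsSquare (ordCompl[2] (d₁ * d₂))), u d₂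
        = ∑ d₁ ∈ 𝒟, ∑ d₂ ∈ 𝒟, if IsSquare (ordCompl[2] (d₁ * d₂)) then u d₂ else 0 :=
          sum_congr rfl fun d₁ _ => by rw [sum_filter]
      _ = ∑ d₂ ∈ 𝒟, ∑ d₁ ∈ 𝒟, if IsSquare (ordCompl[2] (d₁ * d₂)) then u d₂ else 0 := sum_comm
      _ = ∑ d₂ ∈ 𝒟, #(𝒟.filter fun d₁ => IsSquare (ordCompl[2] (d₂ * d₁))) * u d₂ := by
          refine sum_congr rfl fun d₂ _ => ?_
          rw [← sum_filter, sum_const, nsmul_eq_mul]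
          simp only [mul_comm d₂]
      _ ≤ ∑ d₂ ∈ 𝒟, 4 * Real.sqrt D₂ * u d₂ :=
          sum_le_sum fun d₂ hd₂ => mul_le_mul_of_nonneg_right (hν d₂ hd₂) (hu0 d₂)
      _ = 4 * Real.sqrt D₂ * ∑ d ∈ 𝒟, u d := by rw [← mul_sum]
  have hnorm : ∑ d ∈ 𝒟, u d = jtNormSq D₁ D₂ γ := by rw [jtNormSq_def]
  -- sum over the pairs
  calc ∑ d₁ ∈ 𝒟, ∑ d₂ ∈ 𝒟.filter (fun d₂ => IsSquare (ordCompl[2] (d₁ * d₂))), ‖jtPairTerm R S γ d₁ d₂‖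
      ≤ ∑ d₁ ∈ 𝒟, ∑ d₂ ∈ 𝒟.filter (fun d₂ => IsSquare (ordCompl[2] (d₁ * d₂))), M / 2 * (u d₁ + u d₂) :=
        sum_le_sum fun d₁ hd₁ => sum_le_sum fun d₂ hd₂ => hpair d₁ hd₁ d₂ (mem_filter.mp hd₂).1
    _ = M / 2 * (∑ d₁ ∈ 𝒟, ∑ d₂ ∈ 𝒟.filter (fun d₂ => IsSquare (ordCompl[2] (d₁ * d₂))), u d₁ +
          ∑ d₁ ∈ 𝒟, ∑ d₂ ∈ 𝒟.filter (fun d₂ => IsSquare (ordCompl[2] (d₁ * d₂))), u d₂) := by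
        rw [← sum_add_distrib, mul_sum]
        refine sum_congr rfl fun d₁ _ => ?_
        rw [← sum_add_distrib, mul_sum]
    _ ≤ M / 2 * (4 * Real.sqrt D₂ * ∑ d ∈ 𝒟, u d + 4 * Real.sqrt D₂ * ∑ d ∈ 𝒟, u d) := by
        gcongr
    _ = 4 * Real.sqrt D₂ * M * jtNormSq D₁ D₂ γ := by rw [hnorm]; ring





/-! ### W5: the pairs with `d₁' d₂'` not a square -/

/-- `√(a + b + c) ≤ √a + √b + √c` for `a, b, c ≥ 0`. [folklore] -/
theorem sqrt_add_three_le {a b c : ℝ} (ha : 0 ≤ a) (hb : 0 ≤ b) (hc : 0 ≤ c) :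
    Real.sqrt (a + b + c) ≤ Real.sqrt a + Real.sqrt b + Real.sqrt c := by
  rw [Real.sqrt_le_left (by positivity)]
  nlinarith [Real.sq_sqrt ha, Real.sq_sqrt hb, Real.sq_sqrt hc, Real.sqrt_nonneg a, Real.sqrt_nonneg b,
    Real.sqrt_nonneg c]

/-- `|∑_{R<r≤2R, (r,n)=1} χ|² ≤ 2 |∑_{r ≤ 2R, (r,n)=1} χ|² + 2 |∑_{r ≤ R, (r,n)=1} χ|²` for the
symbol `χ = (· / m)` (splitting the dyadic range as a difference of initial segments). [folklore] -/
theorem sq_sum_Ioc_coprime_le (R n m : ℕ) :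
    ((∑ r ∈ (Ioc R (2 * R)).filter (fun r => r.Coprime n), J((r : ℤ) | m) : ℤ) : ℝ) ^ 2 ≤
      2 * ((∑ r ∈ (Icc 1 (2 * R)).filter (fun r => r.Coprime n), J((r : ℤ) | m) : ℤ) : ℝ) ^ 2 +
      2 * ((∑ r ∈ (Icc 1 R).filter (fun r => r.Coprime n), J((r : ℤ) | m) : ℤ) : ℝ) ^ 2 := by
  have hunion : (Icc 1 (2 * R)).filter (fun r => r.Coprime n) =
      (Icc 1 R).filter (fun r => r.Coprime n) ∪ (Ioc R (2 * R)).filter (fun r => r.Coprime n) := by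
    rw [← filter_union]
    congr 1
    ext r; simp only [mem_Icc, mem_union, mem_Ioc]; omega
  have hdisj : Disjoint ((Icc 1 R).filter (fun r => r.Coprime n)) ((Ioc R (2 * R)).filter (fun r => r.Coprime n)) := by
    rw [disjoint_left]
    intro r h1 h2
    rw [mem_filter, mem_Icc] at h1
    rw [mem_filter, mem_Ioc] at h2
    omega
  rw [hunion, sum_union hdisj, Int.cast_add]
  nlinarith [sq_nonneg (2 * ((∑ r ∈ (Icc 1 R).filter (fun r => r.Coprime n), J((r : ℤ) | m) : ℤ) : ℝ) +
    ((∑ r ∈ (Ioc R (2 * R)).filter (fun r => r.Coprime n), J((r : ℤ) | m) : ℤ) : ℝ))]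

set_option maxHeartbeats 400000 in
/-- **(11.22), the non-square pairs:** for `0 < ε ≤ 1` there is `C` with, for `R, S ≥ 1`, any
`D₁, D₂` and `γ`:
`∑_{d₁,d₂ ∈ 𝒟, (d₁d₂)' ≠ □} |T(d₁,d₂)| ≤ C (S R^{3/4} + D₂ R + D₂ √(RS)) (D₂RS)^ε ‖γ‖²`
(Cauchy's inequality (11.21) with `σ(γ) ≤ ‖γ‖⁴` (`sum_range_lcm_mul_mod_le`), the per-pair bound
`exists_pair_form_bound` (Poisson), and Lemma 11.4 for the zero frequency).
[cite: FriedlanderIwaniecAnnals1998, §11, (11.21)-(11.22)] -/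
theorem exists_nonsquare_part_le {ε : ℝ} (hε : 0 < ε) (hε1 : ε ≤ 1) :
    ∃ C : ℝ, 0 < C ∧ ∀ (D₁ D₂ R S : ℕ) (γ : ℕ → ℕ → ℂ), 1 ≤ R → 1 ≤ S →
      ∑ d₁ ∈ Ioc D₁ D₂, ∑ d₂ ∈ (Ioc D₁ D₂).filter (fun d₂ => ¬IsSquare (ordCompl[2] (d₁ * d₂))),
        ‖jtPairTerm R S γ d₁ d₂‖ ≤
        C * ((S : ℝ) * (R : ℝ) ^ (3 / 4 : ℝ) + D₂ * R + D₂ * Real.sqrt ((R : ℝ) * S)) *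
          ((D₂ : ℝ) * R * S) ^ ε * jtNormSq D₁ D₂ γ := by
  have hε2 : 0 < ε / 2 := half_pos hε
  have hε2' : ε / 2 ≤ 1 / 2 := by linarith
  obtain ⟨Cp, hCp0, hCp⟩ := exists_pair_form_bound hε2 hε2'
  obtain ⟨Cg, hCg0, hCg⟩ := exists_norm_fourier_jtBumpC_le
  obtain ⟨C4, hC40, hC4⟩ := sum_sq_coprime_jacobiSym_div_lcm_le hε2
  set Cq : ℝ := 42 * Cg ^ 2 * C4 + Cp with hCq
  refine ⟨Real.sqrt Cq, Real.sqrt_pos.mpr (by positivity), fun D₁ D₂ R S γ hR hS => ?_⟩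
  set 𝒟 := Ioc D₁ D₂ with h𝒟
  have hR1 : (1 : ℝ) ≤ R := by exact_mod_cast hR
  have hS1 : (1 : ℝ) ≤ S := by exact_mod_cast hS
  have hSr : (0 : ℝ) < S := by linarith
  have hRr : (0 : ℝ) < R := by linarith
  -- trivial case `D₂ = 0`
  rcases Nat.eq_zero_or_pos D₂ with hD0 | hD₂
  · have : 𝒟 = ∅ := by rw [h𝒟, hD0]; exact Ioc_eq_empty (by omega)
    rw [this, sum_empty]
    exact mul_nonneg (mul_nonneg (mul_nonneg (Real.sqrt_nonneg _) (by positivity)) (by positivity))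
      (jtNormSq_nonneg _ _ _)
  have hD1 : (1 : ℝ) ≤ D₂ := by exact_mod_cast hD₂
  have hD0 : (0 : ℝ) ≤ D₂ := Nat.cast_nonneg D₂
  have h𝒟mem : ∀ d ∈ 𝒟, 0 < d ∧ d ≤ D₂ := fun d hd => by
    rw [h𝒟, mem_Ioc] at hd; exact ⟨by omega, hd.2⟩
  -- the index set of pairs and of triples
  set NSQ := (𝒟 ×ˢ 𝒟).filter (fun p : ℕ × ℕ => ¬IsSquare (ordCompl[2] (p.1 * p.2))) with hNSQ
  set u : ℕ → ℝ := fun d => ∑ a ∈ range d, ‖γ d a‖ ^ 2 with hu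
  have hu0 : ∀ d, 0 ≤ u d := fun d => sum_nonneg fun _ _ => by positivity
  set Y : ℕ × ℕ → ℕ → ℂ := fun p a =>
    ∑ r ∈ (Ioc R (2 * R)).filter (fun r => r.Coprime (p.1 * p.2)), (jtChar (p.1 * p.2) r : ℂ) *
      ∑ s ∈ (range (3 * S)).filter
        (fun s : ℕ => (Nat.lcm p.1 p.2 : ℤ) ∣ (s : ℤ) - ((a * r : ℕ) : ℤ)), (jtMajorant S s : ℂ) with hY
  -- Step 1: rewrite as a sum over `NSQ` and bound each term by the triple sum
  have hstep1 : ∑ d₁ ∈ 𝒟, ∑ d₂ ∈ 𝒟.filter (fun d₂ => ¬IsSquare (ordCompl[2] (d₁ * d₂))),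
      ‖jtPairTerm R S γ d₁ d₂‖ ≤
      ∑ x ∈ NSQ.sigma (fun p => range (Nat.lcm p.1 p.2)),
        (‖γ x.1.1 (x.2 % x.1.1)‖ * ‖γ x.1.2 (x.2 % x.1.2)‖) * ‖Y x.1 x.2‖ := by
    rw [sum_sigma]
    have : ∑ d₁ ∈ 𝒟, ∑ d₂ ∈ 𝒟.filter (fun d₂ => ¬IsSquare (ordCompl[2] (d₁ * d₂))),
        ‖jtPairTerm R S γ d₁ d₂‖ = ∑ p ∈ NSQ, ‖jtPairTerm R S γ p.1 p.2‖ := by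
      rw [hNSQ, sum_filter, sum_product]
      refine sum_congr rfl fun d₁ _ => ?_
      rw [sum_filter]
    rw [this]
    refine sum_le_sum fun p _ => ?_
    rw [jtPairTerm_def]
    refine (norm_sum_le _ _).trans (sum_le_sum fun a _ => ?_)
    rw [norm_mul, norm_mul, Complex.norm_conj]
  -- Step 2: Cauchy–Schwarz
  have hCS := Real.sum_mul_le_sqrt_mul_sqrt (NSQ.sigma (fun p => range (Nat.lcm p.1 p.2)))
    (fun x => ‖γ x.1.1 (x.2 % x.1.1)‖ * ‖γ x.1.2 (x.2 % x.1.2)‖) (fun x => ‖Y x.1 x.2‖)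
  -- Step 3: the `γ`-factor
  have hγ : ∑ x ∈ NSQ.sigma (fun p => range (Nat.lcm p.1 p.2)),
      (‖γ x.1.1 (x.2 % x.1.1)‖ * ‖γ x.1.2 (x.2 % x.1.2)‖) ^ 2 ≤ (jtNormSq D₁ D₂ γ) ^ 2 := by
    rw [sum_sigma]
    calc ∑ p ∈ NSQ, ∑ a ∈ range (Nat.lcm p.1 p.2), (‖γ p.1 (a % p.1)‖ * ‖γ p.2 (a % p.2)‖) ^ 2
        ≤ ∑ p ∈ 𝒟 ×ˢ 𝒟, ∑ a ∈ range (Nat.lcm p.1 p.2), (‖γ p.1 (a % p.1)‖ * ‖γ p.2 (a % p.2)‖) ^ 2 :=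
          sum_le_sum_of_subset_of_nonneg (filter_subset _ _) fun _ _ _ => sum_nonneg fun _ _ => by positivity
      _ ≤ ∑ p ∈ 𝒟 ×ˢ 𝒟, u p.1 * u p.2 := by
          refine sum_le_sum fun p hp => ?_
          rw [mem_product] at hp
          have h := sum_range_lcm_mul_mod_le (h𝒟mem p.1 hp.1).1 (h𝒟mem p.2 hp.2).1
            (u := fun a => ‖γ p.1 a‖ ^ 2) (v := fun a => ‖γ p.2 a‖ ^ 2) (fun _ => by positivity)
            (fun _ => by positivity)
          refine le_trans (le_of_eq (sum_congr rfl fun a _ => by rw [mul_pow])) h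
      _ = (jtNormSq D₁ D₂ γ) ^ 2 := by
          rw [jtNormSq_def, sq, sum_mul_sum, ← sum_product']
  -- Step 4: the `Y`-factor
  have hYsum : ∑ x ∈ NSQ.sigma (fun p => range (Nat.lcm p.1 p.2)), ‖Y x.1 x.2‖ ^ 2 ≤
      Cq * ((S : ℝ) ^ 2 * (R : ℝ) ^ (3 / 2 : ℝ) + (D₂ : ℝ) ^ 2 * R ^ 2 + (D₂ : ℝ) ^ 2 * R * S) *
        (((D₂ : ℝ) * R * S) ^ ε) ^ 2 := by
    rw [sum_sigma]
    -- per pair: the Poisson bound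
    have hpp : ∀ p ∈ NSQ, ∑ a ∈ range (Nat.lcm p.1 p.2), ‖Y p a‖ ^ 2 ≤
        3 * (Cg * S) ^ 2 * (((∑ r ∈ (Ioc R (2 * R)).filter (fun r => r.Coprime (p.1 * p.2)),
          J((r : ℤ) | ordCompl[2] (p.1 * p.2)) : ℤ) : ℝ) ^ 2 / (Nat.lcm p.1 p.2 : ℝ)) +
          Cp * R * ((R : ℝ) + S) * (((D₂ : ℝ) ^ 2) * R * S) ^ (ε / 2) := by
      intro p hp
      rw [hNSQ, mem_filter, mem_product] at hp
      obtain ⟨⟨hp1, hp2⟩, -⟩ := hp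
      have h1 := (h𝒟mem p.1 hp1).1
      have h2 := (h𝒟mem p.2 hp2).1
      have hq : 1 ≤ Nat.lcm p.1 p.2 := Nat.lcm_pos h1 h2
      have hqD : (Nat.lcm p.1 p.2 : ℝ) ≤ (D₂ : ℝ) ^ 2 := by
        have : Nat.lcm p.1 p.2 ≤ p.1 * p.2 := Nat.le_of_dvd (Nat.mul_pos h1 h2) (Nat.lcm_dvd_mul _ _)
        have h3 : p.1 * p.2 ≤ D₂ * D₂ := Nat.mul_le_mul (h𝒟mem p.1 hp1).2 (h𝒟mem p.2 hp2).2
        rw [sq]; exact_mod_cast this.trans h3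
      have hb := hCp S R (Nat.lcm p.1 p.2) ((Ioc R (2 * R)).filter (fun r => r.Coprime (p.1 * p.2)))
        (fun r => (jtChar (p.1 * p.2) r : ℂ)) hS hR hq (filter_subset _ _) (fun r => norm_jtChar_le_one _ _)
      have hY' : ∀ a, Y p a = ∑ r ∈ (Ioc R (2 * R)).filter (fun r => r.Coprime (p.1 * p.2)),
          (jtChar (p.1 * p.2) r : ℂ) * ∑ s ∈ (range (3 * S)).filter
            (fun s : ℕ => ((Nat.lcm p.1 p.2 : ℕ) : ℤ) ∣ (s : ℤ) - ((a * r : ℕ) : ℤ)), (jtMajorant S s : ℂ) :=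
        fun a => rfl
      simp only [hY']
      refine hb.trans (add_le_add ?_ ?_)
      · -- the zero frequency
        have hG : ∑ r ∈ (Ioc R (2 * R)).filter (fun r => r.Coprime (p.1 * p.2)), (jtChar (p.1 * p.2) r : ℂ) =
            (((∑ r ∈ (Ioc R (2 * R)).filter (fun r => r.Coprime (p.1 * p.2)),
              J((r : ℤ) | ordCompl[2] (p.1 * p.2)) : ℤ) : ℝ) : ℂ) := by
          push_cast; rfl
        rw [hG, Complex.norm_real, Real.norm_eq_abs, sq_abs]
        have hf0 : ‖𝓕 (jtMajorantC S) 0‖ ≤ Cg * S :=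
          norm_fourier_jtMajorantC_div_le_const hCg hCg0.le hSr 0
        set Gr : ℝ := ((∑ r ∈ (Ioc R (2 * R)).filter (fun r => r.Coprime (p.1 * p.2)),
              J((r : ℤ) | ordCompl[2] (p.1 * p.2)) : ℤ) : ℝ)
        have he : 3 / (Nat.lcm p.1 p.2 : ℝ) * ‖𝓕 (jtMajorantC S) 0‖ ^ 2 * Gr ^ 2 =
            3 * ‖𝓕 (jtMajorantC S) 0‖ ^ 2 * (Gr ^ 2 / (Nat.lcm p.1 p.2 : ℝ)) := by ring
        rw [he]
        have h0 : 0 ≤ Gr ^ 2 / (Nat.lcm p.1 p.2 : ℝ) := by positivity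
        exact mul_le_mul_of_nonneg_right (mul_le_mul_of_nonneg_left
          (pow_le_pow_left₀ (norm_nonneg _) hf0 2) (by norm_num)) h0
      · -- the other frequencies
        refine mul_le_mul_of_nonneg_left (Real.rpow_le_rpow (by positivity) ?_ hε2.le) (by positivity)
        exact mul_le_mul_of_nonneg_right (mul_le_mul_of_nonneg_right hqD hRr.le) hSr.le
    -- sum over the pairs: Lemma 11.4 for the zero frequency
    have hsq2 : ∀ p ∈ NSQ, (((∑ r ∈ (Ioc R (2 * R)).filter (fun r => r.Coprime (p.1 * p.2)),
        J((r : ℤ) | ordCompl[2] (p.1 * p.2)) : ℤ) : ℝ) ^ 2 / (Nat.lcm p.1 p.2 : ℝ)) ≤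
        2 * ((((∑ r ∈ (Icc 1 (2 * R)).filter (fun r => r.Coprime (p.1 * p.2)),
          J((r : ℤ) | ordCompl[2] (p.1 * p.2)) : ℤ) : ℝ) ^ 2 / (Nat.lcm p.1 p.2 : ℝ))) +
        2 * ((((∑ r ∈ (Icc 1 R).filter (fun r => r.Coprime (p.1 * p.2)),
          J((r : ℤ) | ordCompl[2] (p.1 * p.2)) : ℤ) : ℝ) ^ 2 / (Nat.lcm p.1 p.2 : ℝ))) := by
      intro p _
      rw [← mul_div_assoc, ← mul_div_assoc, ← add_div]
      exact div_le_div_of_nonneg_right (sq_sum_Ioc_coprime_le R _ _) (Nat.cast_nonneg _)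
    have hL4 : ∀ X : ℕ, 1 ≤ X → ∑ p ∈ NSQ, (((∑ r ∈ (Icc 1 X).filter (fun r => r.Coprime (p.1 * p.2)),
        J((r : ℤ) | ordCompl[2] (p.1 * p.2)) : ℤ) : ℝ) ^ 2 / (Nat.lcm p.1 p.2 : ℝ)) ≤
        C4 * (X : ℝ) ^ (3 / 2 : ℝ) * ((D₂ : ℝ) * X) ^ (ε / 2) := by
      intro X _
      refine le_trans (sum_le_sum_of_subset_of_nonneg ?_ fun _ _ _ => by positivity) (hC4 D₂ X)
      intro p hp
      rw [hNSQ, mem_filter, mem_product] at hp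
      rw [mem_filter, mem_product, mem_Icc, mem_Icc]
      exact ⟨⟨⟨(h𝒟mem p.1 hp.1.1).1, (h𝒟mem p.1 hp.1.1).2⟩, (h𝒟mem p.2 hp.1.2).1, (h𝒟mem p.2 hp.1.2).2⟩, hp.2⟩
    have hcardNSQ : (#NSQ : ℝ) ≤ (D₂ : ℝ) ^ 2 := by
      calc (#NSQ : ℝ) ≤ #(𝒟 ×ˢ 𝒟) := by exact_mod_cast card_le_card (filter_subset _ _)
        _ = (D₂ - D₁ : ℕ) * (D₂ - D₁ : ℕ) := by rw [card_product, h𝒟, Nat.card_Ioc]; push_cast; ring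
        _ ≤ (D₂ : ℝ) ^ 2 := by
            have : ((D₂ - D₁ : ℕ) : ℝ) ≤ D₂ := by exact_mod_cast Nat.sub_le D₂ D₁
            rw [sq]; exact mul_le_mul this this (Nat.cast_nonneg _) (Nat.cast_nonneg _)
    -- powers of `D₂ R S`
    set P : ℝ := (D₂ : ℝ) * R * S with hP
    have hP1 : 1 ≤ P := by
      rw [hP]
      have : (1 : ℝ) ≤ (D₂ : ℝ) * R := by nlinarith
      nlinarith
    have hPε1 : 1 ≤ P ^ ε := Real.one_le_rpow hP1 hε.le
    have hpowA : ((D₂ : ℝ) * ((2 * R : ℕ) : ℝ)) ^ (ε / 2) ≤ 2 * P ^ ε := by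
      have h1 : (D₂ : ℝ) * ((2 * R : ℕ) : ℝ) ≤ 2 * P := by
        rw [hP]; push_cast; nlinarith [mul_nonneg hD0 hRr.le]
      have h2P : 1 ≤ 2 * P := by linarith
      calc ((D₂ : ℝ) * ((2 * R : ℕ) : ℝ)) ^ (ε / 2) ≤ (2 * P) ^ (ε / 2) :=
            Real.rpow_le_rpow (by positivity) h1 hε2.le
        _ ≤ (2 * P) ^ ε := Real.rpow_le_rpow_of_exponent_le h2P (by linarith)
        _ = (2 : ℝ) ^ ε * P ^ ε := Real.mul_rpow (by norm_num) (by linarith)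
        _ ≤ 2 * P ^ ε := by
            refine mul_le_mul_of_nonneg_right ?_ (by positivity)
            calc (2 : ℝ) ^ ε ≤ (2 : ℝ) ^ (1 : ℝ) := Real.rpow_le_rpow_of_exponent_le (by norm_num) hε1
              _ = 2 := Real.rpow_one 2
    have hpowB : ((D₂ : ℝ) * (R : ℕ)) ^ (ε / 2) ≤ P ^ ε := by
      have h1 : (D₂ : ℝ) * (R : ℕ) ≤ P := by rw [hP]; nlinarith [mul_nonneg hD0 hRr.le]
      calc ((D₂ : ℝ) * (R : ℕ)) ^ (ε / 2) ≤ P ^ (ε / 2) := Real.rpow_le_rpow (by positivity) h1 hε2.le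
        _ ≤ P ^ ε := Real.rpow_le_rpow_of_exponent_le hP1 (by linarith)
    have hpowC : (((D₂ : ℝ) ^ 2) * R * S) ^ (ε / 2) ≤ P ^ ε := by
      have h1 : ((D₂ : ℝ) ^ 2) * R * S ≤ P ^ 2 := by
        rw [hP]
        have : (1 : ℝ) ≤ (R : ℝ) * S := by nlinarith
        nlinarith [mul_nonneg (mul_nonneg (sq_nonneg (D₂ : ℝ)) hRr.le) hSr.le]
      calc (((D₂ : ℝ) ^ 2) * R * S) ^ (ε / 2) ≤ (P ^ 2) ^ (ε / 2) :=
            Real.rpow_le_rpow (by positivity) h1 hε2.le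
        _ = P ^ ε := by
            rw [← Real.rpow_natCast, ← Real.rpow_mul (by linarith)]
            congr 1; push_cast; ring
    have h232 : ((2 * R : ℕ) : ℝ) ^ (3 / 2 : ℝ) ≤ 3 * (R : ℝ) ^ (3 / 2 : ℝ) := by
      push_cast
      rw [Real.mul_rpow (by norm_num) hRr.le]
      refine mul_le_mul_of_nonneg_right ?_ (by positivity)
      -- `2^{3/2} ≤ 3` since `2^3 = 8 ≤ 9 = 3^2`
      have : (2 : ℝ) ^ (3 / 2 : ℝ) = Real.sqrt 8 := by
        rw [show (8 : ℝ) = 2 ^ (3 : ℝ) by norm_num, Real.sqrt_eq_rpow, ← Real.rpow_mul (by norm_num)]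
        norm_num
      rw [this, Real.sqrt_le_left (by norm_num)]; norm_num
    -- assemble the `Y`-sum
    have hzero : ∑ p ∈ NSQ, 3 * (Cg * S) ^ 2 * ((((∑ r ∈ (Ioc R (2 * R)).filter (fun r => r.Coprime (p.1 * p.2)),
          J((r : ℤ) | ordCompl[2] (p.1 * p.2)) : ℤ) : ℝ) ^ 2 / (Nat.lcm p.1 p.2 : ℝ))) ≤
        42 * Cg ^ 2 * C4 * ((S : ℝ) ^ 2 * (R : ℝ) ^ (3 / 2 : ℝ)) * P ^ ε := by
      rw [← mul_sum]
      have h2R := hL4 (2 * R) (by omega)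
      have h1R := hL4 R hR
      calc 3 * (Cg * S) ^ 2 * ∑ p ∈ NSQ, ((((∑ r ∈ (Ioc R (2 * R)).filter (fun r => r.Coprime (p.1 * p.2)),
            J((r : ℤ) | ordCompl[2] (p.1 * p.2)) : ℤ) : ℝ) ^ 2 / (Nat.lcm p.1 p.2 : ℝ)))
          ≤ 3 * (Cg * S) ^ 2 * (2 * (C4 * ((2 * R : ℕ) : ℝ) ^ (3 / 2 : ℝ) * ((D₂ : ℝ) * ((2 * R : ℕ) : ℝ)) ^ (ε / 2)) +
              2 * (C4 * (R : ℝ) ^ (3 / 2 : ℝ) * ((D₂ : ℝ) * (R : ℕ)) ^ (ε / 2))) := by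
            refine mul_le_mul_of_nonneg_left ?_ (by positivity)
            refine (sum_le_sum hsq2).trans ?_
            rw [sum_add_distrib, ← mul_sum, ← mul_sum]
            exact add_le_add (mul_le_mul_of_nonneg_left h2R (by norm_num))
              (mul_le_mul_of_nonneg_left h1R (by norm_num))
        _ ≤ 3 * (Cg * S) ^ 2 * (2 * (C4 * (3 * (R : ℝ) ^ (3 / 2 : ℝ)) * (2 * P ^ ε)) +
              2 * (C4 * (R : ℝ) ^ (3 / 2 : ℝ) * P ^ ε)) := by
            gcongr
        _ = 42 * Cg ^ 2 * C4 * ((S : ℝ) ^ 2 * (R : ℝ) ^ (3 / 2 : ℝ)) * P ^ ε := by ring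
    have hrest : ∑ p ∈ NSQ, Cp * R * ((R : ℝ) + S) * (((D₂ : ℝ) ^ 2) * R * S) ^ (ε / 2) ≤
        Cp * ((D₂ : ℝ) ^ 2 * R ^ 2 + (D₂ : ℝ) ^ 2 * R * S) * P ^ ε := by
      rw [sum_const, nsmul_eq_mul]
      calc (#NSQ : ℝ) * (Cp * R * ((R : ℝ) + S) * (((D₂ : ℝ) ^ 2) * R * S) ^ (ε / 2))
          ≤ (D₂ : ℝ) ^ 2 * (Cp * R * ((R : ℝ) + S) * P ^ ε) := by
            refine mul_le_mul hcardNSQ (mul_le_mul_of_nonneg_left hpowC (by positivity)) (by positivity)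
              (by positivity)
        _ = Cp * ((D₂ : ℝ) ^ 2 * R ^ 2 + (D₂ : ℝ) ^ 2 * R * S) * P ^ ε := by ring
    calc ∑ p ∈ NSQ, ∑ a ∈ range (Nat.lcm p.1 p.2), ‖Y p a‖ ^ 2
        ≤ ∑ p ∈ NSQ, (3 * (Cg * S) ^ 2 * (((∑ r ∈ (Ioc R (2 * R)).filter (fun r => r.Coprime (p.1 * p.2)),
            J((r : ℤ) | ordCompl[2] (p.1 * p.2)) : ℤ) : ℝ) ^ 2 / (Nat.lcm p.1 p.2 : ℝ)) +
            Cp * R * ((R : ℝ) + S) * (((D₂ : ℝ) ^ 2) * R * S) ^ (ε / 2)) := sum_le_sum hpp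
      _ ≤ 42 * Cg ^ 2 * C4 * ((S : ℝ) ^ 2 * (R : ℝ) ^ (3 / 2 : ℝ)) * P ^ ε +
            Cp * ((D₂ : ℝ) ^ 2 * R ^ 2 + (D₂ : ℝ) ^ 2 * R * S) * P ^ ε := by
          rw [sum_add_distrib]; exact add_le_add hzero hrest
      _ ≤ Cq * ((S : ℝ) ^ 2 * (R : ℝ) ^ (3 / 2 : ℝ) + (D₂ : ℝ) ^ 2 * R ^ 2 + (D₂ : ℝ) ^ 2 * R * S) * P ^ ε := by
          set X : ℝ := (S : ℝ) ^ 2 * (R : ℝ) ^ (3 / 2 : ℝ) with hX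
          have h1 : 0 ≤ X := by positivity
          have h2 : 0 ≤ (D₂ : ℝ) ^ 2 * R ^ 2 + (D₂ : ℝ) ^ 2 * R * S := by positivity
          have h3 : 0 ≤ P ^ ε := by positivity
          have h42 : (0 : ℝ) ≤ 42 * Cg ^ 2 * C4 := by positivity
          have he : Cq * (X + (D₂ : ℝ) ^ 2 * R ^ 2 + (D₂ : ℝ) ^ 2 * R * S) * P ^ ε =
              42 * Cg ^ 2 * C4 * X * P ^ ε + Cp * ((D₂ : ℝ) ^ 2 * R ^ 2 + (D₂ : ℝ) ^ 2 * R * S) * P ^ ε +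
              (42 * Cg ^ 2 * C4 * ((D₂ : ℝ) ^ 2 * R ^ 2 + (D₂ : ℝ) ^ 2 * R * S) * P ^ ε + Cp * X * P ^ ε) := by
            rw [hCq]; ring
          rw [he]
          linarith [mul_nonneg (mul_nonneg h42 h2) h3, mul_nonneg (mul_nonneg hCp0.le h1) h3]
      _ ≤ Cq * ((S : ℝ) ^ 2 * (R : ℝ) ^ (3 / 2 : ℝ) + (D₂ : ℝ) ^ 2 * R ^ 2 + (D₂ : ℝ) ^ 2 * R * S) * (P ^ ε) ^ 2 :=
          mul_le_mul_of_nonneg_left (le_self_pow₀ hPε1 two_ne_zero) (by positivity)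
  -- Step 5: combine
  have hγ0 : 0 ≤ jtNormSq D₁ D₂ γ := jtNormSq_nonneg _ _ _
  set P : ℝ := (D₂ : ℝ) * R * S with hP
  have hsqrt1 : Real.sqrt (∑ x ∈ NSQ.sigma (fun p => range (Nat.lcm p.1 p.2)),
      (‖γ x.1.1 (x.2 % x.1.1)‖ * ‖γ x.1.2 (x.2 % x.1.2)‖) ^ 2) ≤ jtNormSq D₁ D₂ γ := by
    rw [Real.sqrt_le_left hγ0]; exact hγ
  have hsqrt2 : Real.sqrt (∑ x ∈ NSQ.sigma (fun p => range (Nat.lcm p.1 p.2)), ‖Y x.1 x.2‖ ^ 2) ≤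
      Real.sqrt Cq * ((S : ℝ) * (R : ℝ) ^ (3 / 4 : ℝ) + D₂ * R + D₂ * Real.sqrt ((R : ℝ) * S)) * P ^ ε := by
    refine (Real.sqrt_le_sqrt hYsum).trans ?_
    rw [Real.sqrt_mul (by positivity), Real.sqrt_mul (by positivity), Real.sqrt_sq (by positivity)]
    refine mul_le_mul_of_nonneg_right (mul_le_mul_of_nonneg_left ?_ (Real.sqrt_nonneg _)) (by positivity)
    refine (sqrt_add_three_le (by positivity) (by positivity) (by positivity)).trans (le_of_eq ?_)
    have e1 : Real.sqrt ((S : ℝ) ^ 2 * (R : ℝ) ^ (3 / 2 : ℝ)) = S * (R : ℝ) ^ (3 / 4 : ℝ) := by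
      rw [Real.sqrt_mul (sq_nonneg _), Real.sqrt_sq hSr.le, Real.sqrt_eq_rpow, ← Real.rpow_mul hRr.le]
      norm_num
    have e2 : Real.sqrt ((D₂ : ℝ) ^ 2 * R ^ 2) = D₂ * R := by
      rw [← mul_pow, Real.sqrt_sq (by positivity)]
    have e3 : Real.sqrt ((D₂ : ℝ) ^ 2 * R * S) = D₂ * Real.sqrt ((R : ℝ) * S) := by
      rw [mul_assoc, Real.sqrt_mul (sq_nonneg _), Real.sqrt_sq hD0]
    rw [e1, e2, e3]
  calc _ ≤ _ := hstep1
    _ ≤ _ := hCS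
    _ ≤ jtNormSq D₁ D₂ γ * (Real.sqrt Cq * ((S : ℝ) * (R : ℝ) ^ (3 / 4 : ℝ) + D₂ * R + D₂ * Real.sqrt ((R : ℝ) * S)) * P ^ ε) :=
        mul_le_mul hsqrt1 hsqrt2 (Real.sqrt_nonneg _) hγ0
    _ = _ := by ring





/-! ### W6: the estimate (11.23) for the dual form -/

/-- **FI (11.23) (the dual form, before the removal of `DR`).** For `0 < ε ≤ 1` there is `C` with,
for all `D₁, D₂`, `R, S ≥ 1` and all `γ`:
`W ≤ C {RS √D₂/(D₁+1) + (S R^{3/4} + D₂ R + D₂ √(RS)) (D₂RS)^ε} ‖γ‖²`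
(with `D₁ = D`, `D₂ = 2D` this is `W(D) ≪ {D^{-1/2}RS + (SR^{3/4} + D√(RS) + DR)(DRS)^ε}‖γ‖²`,
the printed (11.23) up to the harmless `RS^{3/4}` and `(DR)^ε` versus `(DRS)^ε`).
[cite: FriedlanderIwaniecAnnals1998, §11, (11.23)] -/
theorem exists_jtW_le {ε : ℝ} (hε : 0 < ε) (hε1 : ε ≤ 1) :
    ∃ C : ℝ, 0 < C ∧ ∀ (D₁ D₂ R S : ℕ) (γ : ℕ → ℕ → ℂ), 1 ≤ R → 1 ≤ S →
      jtW D₁ D₂ R S γ ≤ C * ((R : ℝ) * S * Real.sqrt D₂ / (D₁ + 1) +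
        ((S : ℝ) * (R : ℝ) ^ (3 / 4 : ℝ) + D₂ * R + D₂ * Real.sqrt ((R : ℝ) * S)) * ((D₂ : ℝ) * R * S) ^ ε) *
          jtNormSq D₁ D₂ γ := by
  obtain ⟨Cn, hCn0, hCn⟩ := exists_nonsquare_part_le hε hε1
  refine ⟨24 + 12 + Cn, by positivity, fun D₁ D₂ R S γ hR hS => ?_⟩
  have hγ0 : 0 ≤ jtNormSq D₁ D₂ γ := jtNormSq_nonneg _ _ _
  have hR1 : (1 : ℝ) ≤ R := by exact_mod_cast hR
  have hS1 : (1 : ℝ) ≤ S := by exact_mod_cast hS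
  have hRr : (0 : ℝ) < R := by linarith
  have hSr : (0 : ℝ) < S := by linarith
  set 𝒟 := Ioc D₁ D₂ with h𝒟
  -- W ≤ SQ + NSQ
  have hsplit : jtW D₁ D₂ R S γ ≤
      ∑ d₁ ∈ 𝒟, ∑ d₂ ∈ 𝒟.filter (fun d₂ => IsSquare (ordCompl[2] (d₁ * d₂))), ‖jtPairTerm R S γ d₁ d₂‖ +
      ∑ d₁ ∈ 𝒟, ∑ d₂ ∈ 𝒟.filter (fun d₂ => ¬IsSquare (ordCompl[2] (d₁ * d₂))), ‖jtPairTerm R S γ d₁ d₂‖ := by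
    refine (jtW_le_norm_sum_pairTerm hS D₁ D₂ R γ).trans ?_
    refine (norm_sum_le _ _).trans ((sum_le_sum fun d₁ _ => norm_sum_le _ _).trans (le_of_eq ?_))
    rw [← sum_add_distrib]
    exact sum_congr rfl fun d₁ _ => (sum_filter_add_sum_filter_not _ _ _).symm
  have hSQ := square_part_le hS D₁ D₂ R γ
  have hNSQ := hCn D₁ D₂ R S γ hR hS
  -- the square part in the final shape
  set A : ℝ := (R : ℝ) * S * Real.sqrt D₂ / (D₁ + 1) with hA
  set B : ℝ := ((S : ℝ) * (R : ℝ) ^ (3 / 4 : ℝ) + D₂ * R + D₂ * Real.sqrt ((R : ℝ) * S)) *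
    ((D₂ : ℝ) * R * S) ^ ε with hB
  have hA0 : 0 ≤ A := by positivity
  have hB0 : 0 ≤ B := by positivity
  have hSQ' : 4 * Real.sqrt D₂ * (6 * R * S / (D₁ + 1) + 3 * Real.sqrt ((R : ℝ) * S)) ≤ 24 * A + 12 * B := by
    have h1 : 4 * Real.sqrt D₂ * (6 * R * S / ((D₁ : ℝ) + 1)) = 24 * A := by rw [hA]; ring
    have h2 : 4 * Real.sqrt D₂ * (3 * Real.sqrt ((R : ℝ) * S)) ≤ 12 * B := by
      rcases Nat.eq_zero_or_pos D₂ with hD0 | hD₂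
      · rw [hD0, Nat.cast_zero, Real.sqrt_zero]; simp [hB0]
      · have hD1 : (1 : ℝ) ≤ D₂ := by exact_mod_cast hD₂
        have hsqrt : Real.sqrt D₂ ≤ D₂ := by
          rw [Real.sqrt_le_left (by linarith)]; nlinarith
        have hP : 1 ≤ ((D₂ : ℝ) * R * S) ^ ε :=
          Real.one_le_rpow (by nlinarith [mul_nonneg (by linarith : (0:ℝ) ≤ D₂) hRr.le]) hε.le
        have hRS : 0 ≤ Real.sqrt ((R : ℝ) * S) := Real.sqrt_nonneg _
        calc 4 * Real.sqrt D₂ * (3 * Real.sqrt ((R : ℝ) * S)) = 12 * (Real.sqrt D₂ * Real.sqrt ((R : ℝ) * S)) := by ring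
          _ ≤ 12 * ((D₂ * Real.sqrt ((R : ℝ) * S)) * ((D₂ : ℝ) * R * S) ^ ε) := by
              refine mul_le_mul_of_nonneg_left ?_ (by norm_num)
              calc Real.sqrt D₂ * Real.sqrt ((R : ℝ) * S) ≤ D₂ * Real.sqrt ((R : ℝ) * S) :=
                    mul_le_mul_of_nonneg_right hsqrt hRS
                _ = D₂ * Real.sqrt ((R : ℝ) * S) * 1 := (mul_one _).symm
                _ ≤ _ := mul_le_mul_of_nonneg_left hP (by positivity)
          _ ≤ 12 * B := by
              rw [hB]
              refine mul_le_mul_of_nonneg_left (mul_le_mul_of_nonneg_right ?_ (by positivity)) (by norm_num)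
              have : 0 ≤ (S : ℝ) * (R : ℝ) ^ (3 / 4 : ℝ) + D₂ * R := by positivity
              linarith
    rw [mul_add]
    linarith
  calc jtW D₁ D₂ R S γ ≤ _ := hsplit
    _ ≤ 4 * Real.sqrt D₂ * (6 * R * S / (D₁ + 1) + 3 * Real.sqrt ((R : ℝ) * S)) * jtNormSq D₁ D₂ γ +
          Cn * ((S : ℝ) * (R : ℝ) ^ (3 / 4 : ℝ) + D₂ * R + D₂ * Real.sqrt ((R : ℝ) * S)) *
            ((D₂ : ℝ) * R * S) ^ ε * jtNormSq D₁ D₂ γ := add_le_add hSQ hNSQ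
    _ ≤ (24 * A + 12 * B) * jtNormSq D₁ D₂ γ + Cn * B * jtNormSq D₁ D₂ γ := by
        refine add_le_add (mul_le_mul_of_nonneg_right hSQ' hγ0) (le_of_eq ?_)
        rw [hB]; ring
    _ ≤ (24 + 12 + Cn) * (A + B) * jtNormSq D₁ D₂ γ := by
        have : (24 + 12 + Cn) * (A + B) * jtNormSq D₁ D₂ γ =
            (24 * A + 12 * B) * jtNormSq D₁ D₂ γ + Cn * B * jtNormSq D₁ D₂ γ +
            ((12 + Cn) * A + 24 * B) * jtNormSq D₁ D₂ γ := by ring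
        rw [this]
        have : 0 ≤ ((12 + Cn) * A + 24 * B) * jtNormSq D₁ D₂ γ := by positivity
        linarith


end Literature.NumberTheory.Sieve.FriedlanderIwaniecPrimes
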